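import Summits.AtomisticToContinuum.HydrodynamicLimit.Theorems.LambertianContactSwapLambertianEulerLawSemigroup
import Summits.AtomisticToContinuum.HydrodynamicLimit.Theorems.LambertianContactSwapLambertianEulerJointMeasurable
import HarnessLib

/-!
# Restart of bounded window functionals of the Lambertian gas (first line of the entropy route to the hearts P3Λ/P4Λ; line `Sketch`, crux stmt-11854)

Support file (`--supports stmt-AtomisticToContinuum-11854`).  Step (ENT), first half, of lead c6's dissection of the research hearts
(`Cruxes/LambertianEuler/Lines/Sketch.md` §c6.3): the expectation of a WINDOW TIME-INTEGRAL of a bounded, jointly measurable,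
time-dependent one-time observable `G(r, ·)` along the Lambertian flow `Λ` over `[s, s+h]`, under `P ⊗ γ^ℕ` (`P ≪ liouville` a
probability law, `γ^ℕ = lambertNoise` the i.i.d. Gaussian redraws), equals the expectation of the same functional over `[0, h]`
along `Λ` RESTARTED from the law `μ_s` of `Λ_s` with fresh noise:
`E_{P⊗γ}[∫_s^{s+h} G(r, Λ_r) dr] = E_{μ_s⊗γ}[∫_0^h G(s+r, Λ_r) dr]` (`integral_window_restart`).
Only one-time marginals enter (Fubini twice + the law semigroup `stub_lawSemigroupLambda` p120622 pointwise in `r` +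
`integral_map`), so no path-space Markov property is needed.  Combined with the entropy inequality across the shared noise factor
(`…LambertianEulerRestartEntropyInequality.integral_prod_noise_ge`, p135760) at `μ = μ_s`, `R = ψ_s`:
`−E_{λ⊗γ}[∫_s^{s+h} G(r,Λ_r) dr] ≤ β⁻¹ (H_N(s) + log E_{ψ_s⊗γ} exp(−β ∫_0^h G(s+r, Λ_r) dr))` for the CLAMPED (bounded) currents of
the hearts — what is then left is the window exponential moment under the local Gibbs start (KCW-Λ / CCW-Λ, research).
Lead prover-line-stmt-AtomisticToContinuum-11854-c6-0, 2026-08-17.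
-/

noncomputable section

namespace Summit.AtomisticToContinuum.HydrodynamicLimit.Theorems.LambertianContactSwapLambertianEulerWindowRestart

open scoped BigOperators Topology ENNReal
open MeasureTheory ProbabilityTheory Filter Set
open Literature.MathematicalPhysics.KineticTheory
open Literature.Analysis.FluidPDE Literature.Analysis.FluidPDE.Alexander

/-- **Restart of bounded window functionals of `Λ`** (registered sub-goal `integral_window_restart` of stmt-11854).  For
`0 < σ < 1/2`, `N + 1` spheres of diameter `hsDiameter σ N` on `𝕋³`, a probability law `P ≪ liouville`, a jointly measurable
bounded `G : ℝ × Config → ℝ` and `s, h ≥ 0`: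
`∫ (∫_s^{s+h} G(r, Λ_r(z;ξs)) dr) d(P⊗γ^ℕ)(z,ξs) = ∫ (∫_0^h G(s+r, Λ_r(z′;ξs′)) dr) d(μ_s⊗γ^ℕ)(z′,ξs′)`,
`μ_s = (P ⊗ γ^ℕ) ∘ Λ_s⁻¹`.  Proof: shift the window (`intervalIntegral.integral_comp_add_left`), Fubini on both sides (bounded
integrands on finite product measures, joint measurability of `Λ` p128074), and pointwise in `r ≥ 0` the one-time identity
`E_{P⊗γ}[G(s+r, Λ_{s+r})] = ∫ G(s+r, ·) d((P⊗γ)∘Λ_{s+r}⁻¹) = ∫ G(s+r, ·) d((μ_s⊗γ)∘Λ_r⁻¹) = E_{μ_s⊗γ}[G(s+r, Λ_r)]`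
(`integral_map`, law semigroup p120622). [folklore] -/
theorem integral_window_restart : ∀ {σ : ℝ}, 0 < σ → σ < 2⁻¹ → ∀ (N : ℕ)
    (P : Measure (Config (N + 1) (Fin 3) T3)) [IsProbabilityMeasure P],
    P ≪ liouville (Torus.geometry (Fin 3)) (N + 1) (hsDiameter σ N) →
    ∀ (G : ℝ × Config (N + 1) (Fin 3) T3 → ℝ), Measurable G → ∀ B : ℝ, (∀ x, |G x| ≤ B) →
    ∀ (s h : ℝ), 0 ≤ s → 0 ≤ h →
    ∫ p, (∫ r in s..(s + h), G (r, lambertFlow (Torus.geometry (Fin 3)) (hsDiameter σ N) p.2 p.1 r))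
        ∂((P.prod (lambertNoise (Fin 3)))) =
      ∫ q, (∫ r in (0 : ℝ)..h, G (s + r, lambertFlow (Torus.geometry (Fin 3)) (hsDiameter σ N) q.2 q.1 r))
        ∂((((P.prod (lambertNoise (Fin 3))).map
            (fun p => lambertFlow (Torus.geometry (Fin 3)) (hsDiameter σ N) p.2 p.1 s))).prod (lambertNoise (Fin 3))) := by
  intro σ hσ hσ' N P _ hP G hG B hB s h hs hh
  -- notation
  set κ : Measure (Config (N + 1) (Fin 3) T3 × (ℕ → V3)) := P.prod (lambertNoise (Fin 3)) with hκ
  have hmeasΛ : ∀ t : ℝ, Measurable fun p : Config (N + 1) (Fin 3) T3 × (ℕ → V3) =>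
      lambertFlow (Torus.geometry (Fin 3)) (hsDiameter σ N) p.2 p.1 t :=
    fun t => measurable_lambertFlow_hsDiameter hσ.le hσ' N t
  set μs : Measure (Config (N + 1) (Fin 3) T3) :=
    κ.map (fun p => lambertFlow (Torus.geometry (Fin 3)) (hsDiameter σ N) p.2 p.1 s) with hμs
  haveI : IsProbabilityMeasure μs := Measure.isProbabilityMeasure_map (hmeasΛ s).aemeasurable
  set κ' : Measure (Config (N + 1) (Fin 3) T3 × (ℕ → V3)) := μs.prod (lambertNoise (Fin 3)) with hκ'
  set ν : Measure ℝ := volume.restrict (Ioc 0 h) with hν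
  have hΛu := LambertianContactSwapLambertianEulerJointMeasurable.measurable_lambertFlow_uncurry_torus hσ.le hσ' N
  -- Step 1: shift the window on the left-hand side
  have hshift : ∀ p : Config (N + 1) (Fin 3) T3 × (ℕ → V3),
      ∫ r in s..(s + h), G (r, lambertFlow (Torus.geometry (Fin 3)) (hsDiameter σ N) p.2 p.1 r) =
        ∫ r in (0 : ℝ)..h, G (s + r, lambertFlow (Torus.geometry (Fin 3)) (hsDiameter σ N) p.2 p.1 (s + r)) := by
    intro p
    have h1 := intervalIntegral.integral_comp_add_left
      (fun x => G (x, lambertFlow (Torus.geometry (Fin 3)) (hsDiameter σ N) p.2 p.1 x)) s (a := 0) (b := h)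
    simp only [add_zero] at h1
    exact h1.symm
  simp_rw [hshift]
  -- Step 2: joint measurability and integrability of the two integrands on the finite product measures
  have hmL : Measurable fun q : (Config (N + 1) (Fin 3) T3 × (ℕ → V3)) × ℝ =>
      G (s + q.2, lambertFlow (Torus.geometry (Fin 3)) (hsDiameter σ N) q.1.2 q.1.1 (s + q.2)) := by
    have hcomp : Measurable fun q : (Config (N + 1) (Fin 3) T3 × (ℕ → V3)) × ℝ =>
        lambertFlow (Torus.geometry (Fin 3)) (hsDiameter σ N) q.1.2 q.1.1 (s + q.2) :=
      hΛu.comp (measurable_fst.prodMk (measurable_const.add measurable_snd))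
    exact hG.comp ((measurable_const.add measurable_snd).prodMk hcomp)
  have hmR : Measurable fun q : (Config (N + 1) (Fin 3) T3 × (ℕ → V3)) × ℝ =>
      G (s + q.2, lambertFlow (Torus.geometry (Fin 3)) (hsDiameter σ N) q.1.2 q.1.1 q.2) :=
    hG.comp ((measurable_const.add measurable_snd).prodMk hΛu)
  have hIL : Integrable (fun q : (Config (N + 1) (Fin 3) T3 × (ℕ → V3)) × ℝ =>
      G (s + q.2, lambertFlow (Torus.geometry (Fin 3)) (hsDiameter σ N) q.1.2 q.1.1 (s + q.2))) (κ.prod ν) := by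
    refine (integrable_const B).mono' hmL.aestronglyMeasurable (ae_of_all _ fun q => ?_)
    rw [Real.norm_eq_abs]
    exact hB _
  have hIR : Integrable (fun q : (Config (N + 1) (Fin 3) T3 × (ℕ → V3)) × ℝ =>
      G (s + q.2, lambertFlow (Torus.geometry (Fin 3)) (hsDiameter σ N) q.1.2 q.1.1 q.2)) (κ'.prod ν) := by
    refine (integrable_const B).mono' hmR.aestronglyMeasurable (ae_of_all _ fun q => ?_)
    rw [Real.norm_eq_abs]
    exact hB _
  -- Fubini on both sides
  have hswapL := MeasureTheory.integral_integral_swap (μ := κ) (ν := ν)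
    (f := fun (p : Config (N + 1) (Fin 3) T3 × (ℕ → V3)) (r : ℝ) =>
      G (s + r, lambertFlow (Torus.geometry (Fin 3)) (hsDiameter σ N) p.2 p.1 (s + r))) hIL
  have hswapR := MeasureTheory.integral_integral_swap (μ := κ') (ν := ν)
    (f := fun (q : Config (N + 1) (Fin 3) T3 × (ℕ → V3)) (r : ℝ) =>
      G (s + r, lambertFlow (Torus.geometry (Fin 3)) (hsDiameter σ N) q.2 q.1 r)) hIR
  simp only [intervalIntegral.integral_of_le hh]
  rw [hswapL, hswapR]
  -- Step 3: pointwise in `r ∈ (0, h]`, the one-time identity through the law semigroup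
  refine setIntegral_congr_fun measurableSet_Ioc fun r hr => ?_
  have hr0 : 0 ≤ r := hr.1.le
  have hsem := LambertianContactSwapLambertianEulerLawSemigroup.stub_lawSemigroupLambda hσ hσ' N P hP s r hs hr0
  have hGr : Measurable fun w : Config (N + 1) (Fin 3) T3 => G (s + r, w) := hG.comp (measurable_const.prodMk measurable_id)
  have hL : ∫ p, G (s + r, lambertFlow (Torus.geometry (Fin 3)) (hsDiameter σ N) p.2 p.1 (s + r)) ∂κ =
      ∫ w, G (s + r, w) ∂(κ.map (fun p => lambertFlow (Torus.geometry (Fin 3)) (hsDiameter σ N) p.2 p.1 (s + r))) :=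
    (integral_map (hmeasΛ (s + r)).aemeasurable hGr.aestronglyMeasurable).symm
  have hmeasΛ' : Measurable fun q : Config (N + 1) (Fin 3) T3 × (ℕ → V3) =>
      lambertFlow (Torus.geometry (Fin 3)) (hsDiameter σ N) q.2 q.1 r := hmeasΛ r
  have hR : ∫ q, G (s + r, lambertFlow (Torus.geometry (Fin 3)) (hsDiameter σ N) q.2 q.1 r) ∂κ' =
      ∫ w, G (s + r, w) ∂(κ'.map (fun q => lambertFlow (Torus.geometry (Fin 3)) (hsDiameter σ N) q.2 q.1 r)) :=
    (integral_map hmeasΛ'.aemeasurable hGr.aestronglyMeasurable).symm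
  rw [hL, hR, hκ', hμs, hκ, hsem]

end Summit.AtomisticToContinuum.HydrodynamicLimit.Theorems.LambertianContactSwapLambertianEulerWindowRestart
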